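import Literature.Analysis.FluidPDE.ScalarFourierPicard
import Mathlib.MeasureTheory.Integral.IntervalIntegral.FundThmCalculus
import HarnessLib

/-!
# Time derivatives of all orders of the Picard limit on `T^d`

Analysis/FluidPDE proof file, sixth of the files discharging
`Literature.Analysis.FluidPDE.Torus.exists_unique_isClassicalScalarTransportForcedOn`
(torus twin of `NSFourierTimeRegularity`). For the Picard limit `c = picardLim κ T U S a` of
`ScalarFourierPicard`:

* **mild ⇒ differential** (`PicardHyp.hasDerivWithinAt_picardLim`): at every frequency and
  every `t ∈ [0, T]`, `∂ₜ c(t,k) = -νₖ c(t,k) + S(t,k) - N(U(t), c(t))(k)` within `[0, T]`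
  (product rule and the fundamental theorem of calculus on
  `c(t) = e^{-νₖt} a + e^{-νₖt} ∫₀ᵗ e^{νₖs}(S - N) ds`);
* **the bootstrap** (`PicardHyp.exists_coeffFamily`): if `U`, `S` are, on `[0, T]`, the zeroth
  members of coefficient families of every order (the coefficients of `∂ₜⁱuⱼ`, `∂ₜⁱs`), then
  for every `n` there is a coefficient family `W₀ = c, W₁, …, W_n` of order `n`
  (`∂ₜ Wᵢ = Wᵢ₊₁` within `[0, T]`, every decay, continuity), built with `consFamily` /
  `bootRHS` and the closure properties of `ScalarFourierFamily` — the Fourier-side content of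
  "all `∂ₜⁱθ` exist and are smooth in `x` up to `t = 0`" (Krylov 1996, Thm. 8.12.1, Ex. 8.12.4:
  better regularity of solutions for better data).

## References

* N. V. Krylov, *Lectures on Elliptic and Parabolic Equations in Hölder Spaces*, AMS 1996,
  Thm. 8.12.1, Ex. 8.12.4, Thm. 9.2.3. [Krylov1996]
* P. G. Lemarié-Rieusset, *The Navier–Stokes problem in the 21st century*, CRC 2016, §8.5
  (equivalence of mild and differential formulations).
-/

noncomputable section

namespace Literature.Analysis.FluidPDE

namespace ScalarFourier

open MeasureTheory Real Set Filter UnitAddTorus intervalIntegral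
open scoped Topology
open FourierNS (HasDecay clamp)

variable {d : Type*} [Fintype d] [DecidableEq d]
variable {κ T : ℝ} {U : d → ℝ → (d → ℤ) → ℂ} {S : ℝ → (d → ℤ) → ℂ} {a : (d → ℤ) → ℂ}

/-! ### Mild ⇒ differential -/

/-- **Mild ⇒ differential.** The Picard limit `c` satisfies, at every frequency `k` and every
`t ∈ [0, T]`, `∂ₜ c(t,k) = -νₖ c(t,k) + S(t,k) - N(U(t), c(t))(k)` as a derivative within
`[0, T]` (differentiate `c(t) = e^{-νₖt} a + e^{-νₖt} ∫₀ᵗ e^{νₖs} (S - N) ds` by the product rule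
and the fundamental theorem of calculus; equivalence of mild and differential formulations,
Lemarié-Rieusset 2016, §8.5, for the Navier–Stokes twin `FourierNS.PicardHyp.hasDerivWithinAt_limit`). [folklore] -/
theorem PicardHyp.hasDerivWithinAt_picardLim (h : PicardHyp κ T U S a) (k : d → ℤ) {t : ℝ}
    (ht : t ∈ Icc 0 T) :
    HasDerivWithinAt (fun s => picardLim κ T U S a s k)
      (-(heatRate κ k : ℂ) * picardLim κ T U S a t k +
        (S t k - transportSym (fun j => U j t) (picardLim κ T U S a t) k)) (Icc 0 T) t := by
  set c := picardLim κ T U S a with hc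
  set ν := heatRate κ k with hν
  obtain ⟨R, hR0, hcd⟩ := h.hasDecay_picardLim (latOrder d + 1)
  have hcc : ∀ m, Continuous fun t => c t m := h.continuous_picardLim
  set P : ℝ → ℂ := fun s => S s k - transportSym (fun j => U j s) (c s) k with hP
  have hPc : Continuous P := (h.contS k).sub (h.continuous_transportSym hcc hcd k)
  -- `G s = ∫₀ˢ e^{νσ} P(σ) dσ` and its derivative
  set G : ℝ → ℂ := fun s => ∫ σ in (0 : ℝ)..s, Real.exp (ν * σ) • P σ with hG
  have hGi : Continuous fun σ => Real.exp (ν * σ) • P σ := by fun_prop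
  have hG' : ∀ s, HasDerivAt G (Real.exp (ν * s) • P s) s := fun s =>
    (hGi.integral_hasStrictDerivAt 0 s).hasDerivAt
  -- the heat factor and its derivative
  have hE' : ∀ s, HasDerivAt (fun s => Real.exp (-(ν * s))) (-ν * Real.exp (-(ν * s))) s := by
    intro s
    have := ((hasDerivAt_id s).const_mul ν).neg.exp
    simpa [mul_comm] using this
  -- `F s = e^{-νs} a + e^{-νs} G s` is the Duhamel formula
  set F : ℝ → ℂ := fun s => Real.exp (-(ν * s)) • a k + Real.exp (-(ν * s)) • G s with hF
  have hF' : ∀ s, HasDerivAt F (-(ν : ℂ) * F s + P s) s := by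
    intro s
    have h1 : HasDerivAt (fun s => Real.exp (-(ν * s)) • a k) ((-ν * Real.exp (-(ν * s))) • a k) s :=
      (hE' s).smul_const _
    have h2 : HasDerivAt (fun s => Real.exp (-(ν * s)) • G s)
        (Real.exp (-(ν * s)) • (Real.exp (ν * s) • P s) + (-ν * Real.exp (-(ν * s))) • G s) s :=
      (hE' s).smul (hG' s)
    have h3 := h1.add h2
    have hone : Real.exp (-(ν * s)) * Real.exp (ν * s) = 1 := by
      rw [← Real.exp_add]; simp
    have hone' : (Real.exp (-(ν * s)) : ℂ) * (Real.exp (ν * s) : ℂ) = 1 := by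
      rw [← Complex.ofReal_mul, hone, Complex.ofReal_one]
    have heq : (-ν * Real.exp (-(ν * s))) • a k +
        (Real.exp (-(ν * s)) • (Real.exp (ν * s) • P s) + (-ν * Real.exp (-(ν * s))) • G s) =
        -(ν : ℂ) * F s + P s := by
      simp only [hF, Complex.real_smul, Complex.ofReal_mul, Complex.ofReal_neg]
      linear_combination (P s) * hone'
    rw [heq] at h3
    exact h3
  -- on `[0, T]`, `c s k = F s`
  have hcF : ∀ s ∈ Icc 0 T, c s k = F s := by
    intro s hs
    have hfix := h.picardLim_eq_picardMap s k
    rw [← hc] at hfix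
    rw [hfix]
    simp only [picardMap, FourierNS.clamp_of_mem hs, heatFactor_apply, hF, Complex.real_smul]
    congr 1
    rw [hG, ← intervalIntegral.integral_const_mul]
    refine intervalIntegral.integral_congr fun σ _ => ?_
    simp only [Complex.real_smul, ← mul_assoc, hP]
    congr 1
    rw [← Complex.ofReal_mul, ← Real.exp_add, hν]
    congr 1
    ring
  have key := (hF' t).hasDerivWithinAt (s := Icc 0 T)
  rw [← hcF t ht] at key
  exact key.congr (fun s hs => hcF s hs) (hcF t ht)

/-! ### The bootstrap: coefficient families of all orders -/

/-- **Families of all orders for the Picard limit.** Let the drift and source coefficients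
`U`, `S` be, on `[0, T]`, the zeroth members of coefficient families `UF ⱼ`, `SF` of every
order (in the application: the coefficients of `∂ₜⁱ uⱼ`, `∂ₜⁱ s`). Then for every `n` the
Picard limit `c` is the zeroth member of a coefficient family of order `n` on `[0, T]`
(`∂ₜ Wᵢ = Wᵢ₊₁` within `[0, T]`, every decay, continuity): induction on `n` via
`∂ₜ c = -νₖ c + S - N(U, c)` and the closure of families under the heat symbol and the
transport family (`IsCoeffFamily.bootRHS`), as `FourierNS.PicardHyp.exists_family`
(Leray 1934, pp. 220–221, for the Navier–Stokes twin). [folklore] -/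
theorem PicardHyp.exists_coeffFamily (h : PicardHyp κ T U S a)
    {UF : d → ℕ → ℝ → (d → ℤ) → ℂ} {SF : ℕ → ℝ → (d → ℤ) → ℂ}
    (hUF : ∀ n j, IsCoeffFamily T n (UF j)) (hSF : ∀ n, IsCoeffFamily T n SF)
    (hU0 : ∀ j, ∀ t ∈ Icc 0 T, UF j 0 t = U j t) (hS0 : ∀ t ∈ Icc 0 T, SF 0 t = S t) (n : ℕ) :
    ∃ W : ℕ → ℝ → (d → ℤ) → ℂ, W 0 = picardLim κ T U S a ∧ IsCoeffFamily T n W := by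
  set c := picardLim κ T U S a with hc
  have base : IsCoeffFamily T 0 (fun _ => c) :=
    { decay := fun i _ K => by
        obtain ⟨C, -, hC⟩ := h.hasDecay_picardLim K
        exact ⟨C, fun t _ => hC t⟩
      cont := fun i _ m => (h.continuous_picardLim m).continuousOn
      deriv := fun i hi => absurd hi (Nat.not_lt_zero i) }
  induction n with
  | zero => exact ⟨fun _ => c, rfl, base⟩
  | succ n ih =>
    obtain ⟨W, hW0, hW⟩ := ih
    set D := bootRHS κ UF SF W with hD
    have hDf : IsCoeffFamily T n D :=
      IsCoeffFamily.bootRHS h.hT h.hκ.le (fun j => hUF n j) (hSF n) hW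
    refine ⟨consFamily c D, rfl, ?_⟩
    refine ⟨fun i hi K => ?_, fun i hi m => ?_, fun i hi m t ht => ?_⟩
    · cases i with
      | zero => exact base.decay 0 le_rfl K
      | succ i => exact hDf.decay i (by omega) K
    · cases i with
      | zero => exact base.cont 0 le_rfl m
      | succ i => exact hDf.cont i (by omega) m
    · cases i with
      | zero =>
        have hd := h.hasDerivWithinAt_picardLim m ht
        simp only [consFamily_zero, consFamily_succ, zero_add]
        convert hd using 1
        simp only [hD, bootRHS_apply, hW0, transportFamily_zero, hS0 t ht, ← hc]
        have hU : (fun j => UF j 0 t) = fun j => U j t := funext fun j => hU0 j t ht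
        rw [hU]
        ring
      | succ i =>
        simp only [consFamily_succ]
        exact hDf.deriv i (by omega) m t ht

end ScalarFourier

end Literature.Analysis.FluidPDE

end
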